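import Literature.AnabelianGeometry.AbsoluteAnabelian.HolomorphicEllipticCuspidalizationDenseModel
import Literature.AnabelianGeometry.AbsoluteAnabelian.HolomorphicEllipticCuspidalizationModelProofs
import Literature.AnabelianGeometry.AbsoluteAnabelian.HolomorphicEllipticCuspidalizationTransportProofs
import HarnessLib

/-!
# [AbsTopIII] Cor 2.7 (c): `TorsionPointsDenseUniqueGroupLaw` from the uniformization of genus one

Final assembly (proof-only, theorems only) of the sub-DAG of [AbsTopIII] Corollary 2.7 (a)(b)(c)(e)
(S. Mochizuki, *Topics in absolute anabelian geometry III*, kurims pp. 58–60, lit key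
`paper:url-5493eb38cbb7`; statements `HolomorphicEllipticCuspidalization.lean` p414370, table
`plan/L4/SUBDAG-AbsTopIII-Cor-27.md`).  With the sub-nodes landed by seats abc-iut-w5-d226
((b).1, (b).3), abc-iut-L4-t12 ((b).2, (b).4–(b).6, (c).1, (c).2, (c).6), abc-iut-w5-d245 ((c).4 from
(c).3: `puncturedEllipticCurveModel_of_genusOneUniformization`) and abc-iut-w5-d140 ((c).5:
`cuspidalTorsionPointsTransport_holds`), the named fact of Cor 2.7 (c) — "Since the torsion points of
(b) are dense in `E^top`, one may construct the group structure on [the one-point compactification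
of] `E^top` … as the unique topological group structure that extends the group structure on the
torsion points of (b)" (p. 59), typed as `TorsionPointsDenseUniqueGroupLaw` (density ∧ uniqueness) —
follows from the ONE classical input left, sub-node (c).3 `GenusOneUniformization` (Farkas–Kra,
*Riemann Surfaces*, Thm IV.6.1 (c): a compact Riemann surface homeomorphic to a torus is `ℂ/Λ`;
GAP-LEDGER G-L4t12g4-1), which the conformal-topological typing of `IsPuncturedEllipticCurve` forces:

* `torsionPointsDenseUniqueGroupLaw_of_genusOneUniformization :
    GenusOneUniformization → TorsionPointsDenseUniqueGroupLaw`.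

HONEST FRAMING: OUR kernel check of a statement of a refereed paper modulo a named classical
theorem; nothing here bears on the disputed [IUTchIII] Cor. 3.12.
-/

namespace Literature.AnabelianGeometry.AbsoluteAnabelian

open scoped _root_.Manifold _root_.ContDiff

namespace HolomorphicEllipticCuspidalization

/-- **[AbsTopIII] Cor 2.7 (c) modulo the uniformization of genus-one surfaces**: the named fact
`TorsionPointsDenseUniqueGroupLaw` (for every punctured elliptic curve in the typed conformal sense:
the cuspidal torsion points are dense, and two topological group laws on the one-point
compactification agreeing on them coincide) follows from `GenusOneUniformization` alone — via (c).4
(model of a punctured elliptic curve, abc-iut-w5-d245), (c).5 (transport along biholomorphisms,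
abc-iut-w5-d140) and (c).2 (density at the model torus, from the `[N]`-diagrams (b).1–(b).6 and the
density of torsion (c).1). [cite: MochizukiAbsTopIII2015, Corollary 2.7 (c) p.59] -/
theorem torsionPointsDenseUniqueGroupLaw_of_genusOneUniformization (h : GenusOneUniformization) :
    Literature.AnabelianGeometry.AbsoluteAnabelian.TorsionPointsDenseUniqueGroupLaw :=
  torsionPointsDenseUniqueGroupLaw_of_model_transport
    (puncturedEllipticCurveModel_of_genusOneUniformization h) cuspidalTorsionPointsTransport_holds

/-- The same, as the density clause alone: for every punctured elliptic curve in the typed sense the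
cuspidal torsion points are dense, granted `GenusOneUniformization`.
[cite: MochizukiAbsTopIII2015, Corollary 2.7 (c) p.59] -/
theorem dense_cuspidalTorsionPoints_of_genusOneUniformization (h : GenusOneUniformization)
    (E : Type) [TopologicalSpace E] [T2Space E] [ChartedSpace ℂ E]
    [IsManifold 𝓘(ℂ, ℂ) ω E]
    (hE : TorsionPointsDenseUniqueGroupLaw.IsPuncturedEllipticCurve E) :
    Dense (cuspidalTorsionPoints E) :=
  dense_cuspidalTorsionPoints_of_subnodes (puncturedEllipticCurveModel_of_genusOneUniformization h)
    cuspidalTorsionPointsTransport_holds cuspidalTorsionPointsDenseModel_holds E hE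

end HolomorphicEllipticCuspidalization

end Literature.AnabelianGeometry.AbsoluteAnabelian
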